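import Mathlib
import HarnessLib
import Summits.Langlands.Statement
import Summits.Langlands.Langlands.Theses.AuxiliaryLevelSplit
import Summits.Langlands.Langlands.Theses.PrimeSwitchSplit
import Summits.Langlands.Langlands.Theorems.IwahoriTransientSplitLevelFiniteness

/-!
# BanalLevelSplit — lens-3 gen 26 node of the cell `decomp-langlands` (planner-decomp-langlands-lens-3-g26-0, 2026-08-31)

TARGET (by name): ILC = `Summit.Langlands.Langlands.Theorems.IwahoriTransient.IwahoriLevelConfinement` — the DECLARED RESIDUAL of
U = `Summit.Langlands.Langlands.Theses.AuxiliaryLevelSplit.LevelFiniteness` (stmt-Langlands-27042, crux r3 of the OPEN route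
AuxiliaryLevelSplit; tribunal r0 PASS) under the gen-25 certified translation U ⟺ SSH ∧ ILC (tree theorem
`IwahoriTransient.levelFiniteness_iff_pieces`, census twin p822572, critic row 372 CLEARED).  Vocabulary of gens 24–25 reused BY NAME
(`TransientLevel.IsPinnedGeometric / CloseAt / IsLevelFreeProAutomorphic / IsProAutomorphic / IsWeaklyAutomorphic`,
`IwahoriTransient.IsIwahoriSphericalAt / IsLevelRaisingAt / IsShapedProAutomorphic / SemistableShaping / IwahoriLevelConfinement`).

ILC(ρ): for irreducible pinned-geometric `ρ : Γ_K → GL_n(ℚ̄_ℓ)`:  H♯(ρ) «SEMISTABLY SHAPED pro-automorphy: off ONE finite S₀, every deep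
approximant π_r is r-close to ρ or Iwahori-spherical at a depth-r level-raising place of ρ» ⟹ C(ρ) «pro-automorphy of BOUNDED level».

THE ONE CERTIFIED TRANSLATION of this generation (lens-3's single allowed EQUIV, kernel `confinement_iff_pieces`, modulo NOTHING):
    ILC  ⟺  BanalShaping ∧ NonBanalConfinement,
cut at the BANAL / NON-BANAL DIAL on the residual Iwahori places.  A finite place v is NON-BANAL for (ℓ, n) (`IsNonBanalAt ℓ n v`) iff
ℓ ∣ q_v or ℓ ∣ q_vⁱ − 1 for some 1 ≤ i ≤ n — i.e. ℓ divides the pro-order of GL_n(K_v) (Vignéras), equivalently (for v ∤ ℓ) the order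
of q_v modulo ℓ is ≤ n; BANAL otherwise.  This is exactly the print boundary of level lowering / Ihara: Mazur's principle in dimension d
(Boyer, Math. Z. 2026, Thm 5.5: hypothesis «the order of q_v modulo l is strictly greater than d»; d = 2: q_v ≢ 1 mod ℓ — Carayol 1989,
Jarvis 1999) and the generalized Ihara lemma of Clozel–Harris–Taylor proved for BANAL ℓ (arXiv:2504.07504 Thm 1.2, «ℓ ∤ |GL_n(𝔽_q)|»;
Boyer JIMJ 2021) live on the banal side; the non-banal side (q_v ≡ 1 mod ℓ: Ribet's (p,q)-switch, Taylor–Wiles primes, CHT's Ihara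
conjecture in general) is where GL_n level lowering is open.  New intermediate language H♭(ρ) (`IsNonBanallyShapedProAutomorphic`):
H♯ with every residual bad place NON-BANAL.  Ladder of depths:  C ⟹ H♭ ⟹ H♯ ⟹ H∞  (kernels `nonBanallyShaped_of_pro`,
`shaped_of_nonBanallyShaped`, gen-25 `levelFree_of_shaped`), and ILC = (H♯ ⟹ C) splits at H♭:
  • BNS = `BanalShaping` : H♯ ⟹ H♭ — «BANAL IWAHORI LEVEL IS TRANSIENT: off a finite set depending on ρ alone, every sufficiently deep
    approximant can be taken with no residual level at banal places».  Crux rank 2 of the split, WEAKER than ILC (kernel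
    `banalShaping_of_confinement`), OPEN as typed, ATTACKABLE where the print engines live (KHT-Shimura-variety / definite-unitary
    populations: Mazur's principle needs only torsion-freeness + weight–monodromy at banal ℓ; Ihara's lemma is KNOWN at banal ℓ under
    genericity), IDEA-NEEDED in general (ℓ-adic depth r and free weight instead of mod ℓ and fixed weight).
  • NBC = `NonBanalConfinement` : H♭ ⟹ C — «non-banally shaped pro-automorphy ⟹ ONE uniform finite level»: the genuine residual, level
    lowering CONFINED TO NON-BANAL Iwahori places (ℓ ∣ q_vⁱ − 1, i ≤ n: the ℓ-modular representation theory of GL_n(K_v) is not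
    semisimple, cuspidal ≠ supercuspidal, Ihara open).  Crux rank 3, DECLARED RESIDUAL, WEAKER than ILC (kernel
    `nonBanalConfinement_of_confinement`): it is silent about every approximating system with a persistent BANAL bad place.
Both pieces are implied by ILC, hence by U (`…_of_levelFiniteness`), by FERN (`…_of_fernSpread`), by B_w = 17414 (`…_of_weak`) and by the
summit (`…_of_langlands`): no EXCESS.  Neither piece is known to imply ILC (model witnesses §8: a world with every place non-banal — the
ℓ = 2 world, `isNonBanalAt_two` — decides BNS and leaves NBC = ILC; a world with every place banal decides NBC vacuously and refutes the
BNS-analogue).  Three-binder child of U: `closes_target3 : SSH → BNS → NBC → U` (U by name; supersedes the queued 2-binder kit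
IwahoriTransientSplit or is filed beneath it as the grandchild `closes_residual : BNS → NBC → ILC`).  0 sorry; axioms standard.

DIAL FACTS (§7, proved): ℓ = 2 ⇒ every place is non-banal (`isNonBanalAt_two`); ℓ ≤ n + 1 ⇒ every place is non-banal (Fermat,
`isNonBanalAt_of_le`): the banal regime is ℓ ≥ n + 2, as in print («banal ⇒ ℓ > n»); q_v ≡ 1 mod ℓ ⇒ non-banal (`isNonBanalAt_of_dvd_sub_one`).
-/

set_option linter.dupNamespace false
set_option linter.unusedVariables false

namespace Summit.Langlands.Langlands.Theorems.BanalLevel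

open scoped NumberField Polynomial
open Filter Field IsDedekindDomain
open Literature.NumberTheory.GaloisRepresentations Literature.NumberTheory.Automorphic
open Summit.Langlands.Langlands.Theorems.TransientLevel
open Summit.Langlands.Langlands.Theorems.IwahoriTransient

/-! ## 1. Vocabulary (the NEW intermediate language H♭; everything else is imported BY NAME) -/

section Vocabulary

variable {K : Type} [Field K] [NumberField K] {n : ℕ} {ℓ : ℕ} [Fact ℓ.Prime]

/-- `ℓ` is NON-BANAL for `GL_n` at the finite place `v` of `K`: `ℓ ∣ q_v` (ℓ = p, the wild case) or `ℓ ∣ q_vⁱ − 1` for some `1 ≤ i ≤ n`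
(the order of `q_v` modulo `ℓ` is at most `n`), i.e. `ℓ` divides the pro-order `q_v^∞ · ∏_{i ≤ n} (q_vⁱ − 1)` of `GL_n(K_v)` (Vignéras'
banal/non-banal dichotomy; the negation is Boyer's hypothesis «order of q_v mod l > d» and the banality hypothesis «ℓ ∤ |GL_n(𝔽_q)|» of the
generalized Ihara lemma). -/
def IsNonBanalAt (ℓ n : ℕ) (v : HeightOneSpectrum (𝓞 K)) : Prop :=
  ℓ ∣ v.residueCard ∨ ∃ i : ℕ, 1 ≤ i ∧ i ≤ n ∧ ℓ ∣ v.residueCard ^ i - 1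

/-- H♭ · NON-BANALLY SHAPED PRO-AUTOMORPHIC (the NEW intermediate language of this node): ONE finite `S₀` such that for every radius
`r > 0` some L-algebraic cuspidal `π` is `r`-close to `ρ` at almost all places and, at EVERY `v ∉ S₀`, either `r`-close to `ρ` at `v`, or
Iwahori-spherical at `v` with `ρ` level-raising at `v` modulo `r` AND `v` NON-BANAL for `(ℓ, n)`.  (H♯ = the same without the banality clause.) -/
def IsNonBanallyShapedProAutomorphic (hcpt : isCompact_glFiniteIntegralLevel n K) (ι : PadicAlgCl ℓ ≃+* ℂ)
    (ρ : FramedGaloisRep K (PadicAlgCl ℓ) n) : Prop :=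
  ∃ S₀ : Set (HeightOneSpectrum (𝓞 K)), S₀.Finite ∧ ∀ r : NNReal, 0 < r →
    ∃ π : CuspidalAutomorphicRepData n K hcpt, π.1.IsLAlgebraic ∧
      (∀ᶠ v : HeightOneSpectrum (𝓞 K) in cofinite, CloseAt ι π ρ r v) ∧
      ∀ v : HeightOneSpectrum (𝓞 K), v ∉ S₀ → CloseAt ι π ρ r v ∨ (IsIwahoriSphericalAt π v ∧ IsLevelRaisingAt ρ r v ∧ IsNonBanalAt ℓ n v)

end Vocabulary

/-! ## 2. The items (one-line texts = the route kit VERBATIM; generated from the TREE text of ILC by texts26.py) -/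

/-- BNS · BANAL SHAPING · crux rank 2 of the split (deciding) · WEAKER than ILC (`banalShaping_of_confinement`) · OPEN · ATTACKABLE in the
Shimura/definite-unitary populations (Mazur's principle, banal Ihara) · IDEA-NEEDED in general.  ILC's binders and hypothesis H♯ VERBATIM;
conclusion H♭ instead of C. -/
def BanalShaping : Prop :=
  ∀ (K : Type) [Field K] [NumberField K] (n : ℕ) (hcpt : Literature.NumberTheory.Automorphic.isCompact_glFiniteIntegralLevel n K), 0 < n → ∀ (ℓ : ℕ) [Fact ℓ.Prime] (ι : PadicAlgCl ℓ ≃+* ℂ) (ρ : Literature.NumberTheory.GaloisRepresentations.FramedGaloisRep K (PadicAlgCl ℓ) n), ρ.toGaloisRep.IsIrreducible → ((∀ᶠ v : IsDedekindDomain.HeightOneSpectrum (NumberField.RingOfIntegers K) in Filter.cofinite, ρ.IsUnramifiedAt v) ∧ ∀ (v : IsDedekindDomain.HeightOneSpectrum (NumberField.RingOfIntegers K)) (hv : ((ℓ : ℕ) : NumberField.RingOfIntegers K) ∈ v.asIdeal), (Literature.NumberTheory.PAdicHodge.fontainePstAdicCompletion v ℓ hv).IsDeRhamFramed (ρ.toLocal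 v)) → (∃ S₀ : Set (IsDedekindDomain.HeightOneSpectrum (NumberField.RingOfIntegers K)), S₀.Finite ∧ ∀ r : NNReal, 0 < r → ∃ π : Literature.NumberTheory.Automorphic.CuspidalAutomorphicRepData n K hcpt, π.1.IsLAlgebraic ∧ (∀ᶠ v : IsDedekindDomain.HeightOneSpectrum (NumberField.RingOfIntegers K) in Filter.cofinite, (∃ α : Multiset ℂ, π.1.HasSatakeParamAt v α ∧ ∀ 𝔓 ∈ v.primesAbove, ∀ σ : Field.absoluteGaloisGroup K, IsArithFrobAt (NumberField.RingOfIntegers K) σ 𝔓 → ∀ i : ℕ, Valued.v ((Literature.NumberTheory.GaloisRepresentations.FramedRep.charpoly ρ σ - Literature.NumberTheory.Automorphic.arithFrobPolyOfSatake ι v.residueCard 1 α).coeff i) < r)) ∧ ∀ v : IsDedekindDomain.HeightOneSpectrum (NumberField.RingOfIntegers K), v ∉ S₀ → (∃ α : Multiset ℂ, π.1.HasSatakeParamAt v α ∧ ∀ 𝔓 ∈ v.primesAbove, ∀ σ : Field.absoluteGaloisGroup K, IsArithFrobAt (NumberField.RingOfIntegers K) σ 𝔓 → ∀ i : ℕ,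 Valued.v ((Literature.NumberTheory.GaloisRepresentations.FramedRep.charpoly ρ σ - Literature.NumberTheory.Automorphic.arithFrobPolyOfSatake ι v.residueCard 1 α).coeff i) < r) ∨ ((∃ πv : Literature.NumberTheory.Automorphic.SmoothIrrep (Matrix.GeneralLinearGroup (Fin n) (v.adicCompletion K)), π.1.HasLocalComponentAt v πv.ρ ∧ ∃ w : πv.V, w ≠ 0 ∧ ∀ g ∈ Literature.NumberTheory.Automorphic.iwahoriGL n (v.adicCompletion K), πv.ρ g w = w) ∧ (∀ 𝔓 ∈ v.primesAbove, ∀ σ : Field.absoluteGaloisGroup K, IsArithFrobAt (NumberField.RingOfIntegers K) σ 𝔓 → ∃ a b : PadicAlgCl ℓ, ({a, b} : Multiset (PadicAlgCl ℓ)) ≤ (Literature.NumberTheory.GaloisRepresentations.FramedRep.charpoly ρ σ).roots ∧ Valued.v (a - (v.residueCard : PadicAlgCl ℓ) * b) < r))) → ∃ S₀ : Set (IsDedekindDomain.HeightOneSpectrum (NumberField.RingOfIntegers K)), S₀.Finite ∧ ∀ r : NNReal, 0 < r → ∃ π : Literature.NumberTheory.Automorphic.CuspidalAutomorphicRepData n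 K hcpt, π.1.IsLAlgebraic ∧ (∀ᶠ v : IsDedekindDomain.HeightOneSpectrum (NumberField.RingOfIntegers K) in Filter.cofinite, (∃ α : Multiset ℂ, π.1.HasSatakeParamAt v α ∧ ∀ 𝔓 ∈ v.primesAbove, ∀ σ : Field.absoluteGaloisGroup K, IsArithFrobAt (NumberField.RingOfIntegers K) σ 𝔓 → ∀ i : ℕ, Valued.v ((Literature.NumberTheory.GaloisRepresentations.FramedRep.charpoly ρ σ - Literature.NumberTheory.Automorphic.arithFrobPolyOfSatake ι v.residueCard 1 α).coeff i) < r)) ∧ ∀ v : IsDedekindDomain.HeightOneSpectrum (NumberField.RingOfIntegers K), v ∉ S₀ → (∃ α : Multiset ℂ, π.1.HasSatakeParamAt v α ∧ ∀ 𝔓 ∈ v.primesAbove, ∀ σ : Field.absoluteGaloisGroup K, IsArithFrobAt (NumberField.RingOfIntegers K) σ 𝔓 → ∀ i : ℕ, Valued.v ((Literature.NumberTheory.GaloisRepresentations.FramedRep.charpoly ρ σ - Literature.NumberTheory.Automorphic.arithFrobPolyOfSatake ι v.residueCard 1 α).coeff i) < r) ∨ ((∃ πv : Literature.NumberTheory.Automorphic.SmoothIrrep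 (Matrix.GeneralLinearGroup (Fin n) (v.adicCompletion K)), π.1.HasLocalComponentAt v πv.ρ ∧ ∃ w : πv.V, w ≠ 0 ∧ ∀ g ∈ Literature.NumberTheory.Automorphic.iwahoriGL n (v.adicCompletion K), πv.ρ g w = w) ∧ (∀ 𝔓 ∈ v.primesAbove, ∀ σ : Field.absoluteGaloisGroup K, IsArithFrobAt (NumberField.RingOfIntegers K) σ 𝔓 → ∃ a b : PadicAlgCl ℓ, ({a, b} : Multiset (PadicAlgCl ℓ)) ≤ (Literature.NumberTheory.GaloisRepresentations.FramedRep.charpoly ρ σ).roots ∧ Valued.v (a - (v.residueCard : PadicAlgCl ℓ) * b) < r) ∧ (ℓ ∣ v.residueCard ∨ ∃ i : ℕ, 1 ≤ i ∧ i ≤ n ∧ ℓ ∣ v.residueCard ^ i - 1))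

/-- NBC · NON-BANAL CONFINEMENT · crux rank 3 (declared residual) · WEAKER than ILC (`nonBanalConfinement_of_confinement`) · OPEN ·
level lowering at NON-BANAL Iwahori places only (q_v of order ≤ n mod ℓ; Ribet (p,q)-switch / Ihara regime).  ILC's text VERBATIM with the
hypothesis H♯ REPLACED by H♭. -/
def NonBanalConfinement : Prop :=
  ∀ (K : Type) [Field K] [NumberField K] (n : ℕ) (hcpt : Literature.NumberTheory.Automorphic.isCompact_glFiniteIntegralLevel n K), 0 < n → ∀ (ℓ : ℕ) [Fact ℓ.Prime] (ι : PadicAlgCl ℓ ≃+* ℂ) (ρ : Literature.NumberTheory.GaloisRepresentations.FramedGaloisRep K (PadicAlgCl ℓ) n), ρ.toGaloisRep.IsIrreducible → ((∀ᶠ v : IsDedekindDomain.HeightOneSpectrum (NumberField.RingOfIntegers K) in Filter.cofinite, ρ.IsUnramifiedAt v) ∧ ∀ (v : IsDedekindDomain.HeightOneSpectrum (NumberField.RingOfIntegers K)) (hv : ((ℓ : ℕ) : NumberField.RingOfIntegers K) ∈ v.asIdeal), (Literature.NumberTheory.PAdicHodge.fontainePstAdicCompletion v ℓ hv).IsDeRhamFramed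 (ρ.toLocal v)) → (∃ S₀ : Set (IsDedekindDomain.HeightOneSpectrum (NumberField.RingOfIntegers K)), S₀.Finite ∧ ∀ r : NNReal, 0 < r → ∃ π : Literature.NumberTheory.Automorphic.CuspidalAutomorphicRepData n K hcpt, π.1.IsLAlgebraic ∧ (∀ᶠ v : IsDedekindDomain.HeightOneSpectrum (NumberField.RingOfIntegers K) in Filter.cofinite, (∃ α : Multiset ℂ, π.1.HasSatakeParamAt v α ∧ ∀ 𝔓 ∈ v.primesAbove, ∀ σ : Field.absoluteGaloisGroup K, IsArithFrobAt (NumberField.RingOfIntegers K) σ 𝔓 → ∀ i : ℕ, Valued.v ((Literature.NumberTheory.GaloisRepresentations.FramedRep.charpoly ρ σ - Literature.NumberTheory.Automorphic.arithFrobPolyOfSatake ι v.residueCard 1 α).coeff i) < r)) ∧ ∀ v : IsDedekindDomain.HeightOneSpectrum (NumberField.RingOfIntegers K), v ∉ S₀ → (∃ α : Multiset ℂ, π.1.HasSatakeParamAt v α ∧ ∀ 𝔓 ∈ v.primesAbove, ∀ σ : Field.absoluteGaloisGroup K, IsArithFrobAt (NumberField.RingOfIntegers K) σ 𝔓 → ∀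 i : ℕ, Valued.v ((Literature.NumberTheory.GaloisRepresentations.FramedRep.charpoly ρ σ - Literature.NumberTheory.Automorphic.arithFrobPolyOfSatake ι v.residueCard 1 α).coeff i) < r) ∨ ((∃ πv : Literature.NumberTheory.Automorphic.SmoothIrrep (Matrix.GeneralLinearGroup (Fin n) (v.adicCompletion K)), π.1.HasLocalComponentAt v πv.ρ ∧ ∃ w : πv.V, w ≠ 0 ∧ ∀ g ∈ Literature.NumberTheory.Automorphic.iwahoriGL n (v.adicCompletion K), πv.ρ g w = w) ∧ (∀ 𝔓 ∈ v.primesAbove, ∀ σ : Field.absoluteGaloisGroup K, IsArithFrobAt (NumberField.RingOfIntegers K) σ 𝔓 → ∃ a b : PadicAlgCl ℓ, ({a, b} : Multiset (PadicAlgCl ℓ)) ≤ (Literature.NumberTheory.GaloisRepresentations.FramedRep.charpoly ρ σ).roots ∧ Valued.v (a - (v.residueCard : PadicAlgCl ℓ) * b) < r) ∧ (ℓ ∣ v.residueCard ∨ ∃ i : ℕ, 1 ≤ i ∧ i ≤ n ∧ ℓ ∣ v.residueCard ^ i - 1))) → ∃ S : Set (IsDedekindDomain.HeightOneSpectrum (NumberField.RingOfIntegers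 K)), S.Finite ∧ ∀ r : NNReal, 0 < r → ∃ π : Literature.NumberTheory.Automorphic.CuspidalAutomorphicRepData n K hcpt, π.1.IsLAlgebraic ∧ ∀ v : IsDedekindDomain.HeightOneSpectrum (NumberField.RingOfIntegers K), v ∉ S → (∃ α : Multiset ℂ, π.1.HasSatakeParamAt v α ∧ ∀ 𝔓 ∈ v.primesAbove, ∀ σ : Field.absoluteGaloisGroup K, IsArithFrobAt (NumberField.RingOfIntegers K) σ 𝔓 → ∀ i : ℕ, Valued.v ((Literature.NumberTheory.GaloisRepresentations.FramedRep.charpoly ρ σ - Literature.NumberTheory.Automorphic.arithFrobPolyOfSatake ι v.residueCard 1 α).coeff i) < r)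

/-- ResidualAssembly (curried deciding theorem of the split of the residual): BNS → NBC → ILC. -/
def ResidualAssembly : Prop :=
  BanalShaping → NonBanalConfinement → IwahoriLevelConfinement

/-- ChildAssembly3 (curried deciding theorem of the three-binder child of U): SSH → BNS → NBC → U. -/
def ChildAssembly3 : Prop :=
  SemistableShaping → BanalShaping → NonBanalConfinement → Summit.Langlands.Langlands.Theses.AuxiliaryLevelSplit.LevelFiniteness

/-! ## 3. Structured readings (all `Iff.rfl`: the one-liners ARE the structured statements) -/

/-- BNS unfolded (semistably shaped ⇒ non-banally shaped). -/
theorem banalShaping_iff : BanalShaping ↔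
    ∀ (K : Type) [Field K] [NumberField K] (n : ℕ) (hcpt : isCompact_glFiniteIntegralLevel n K), 0 < n →
      ∀ (ℓ : ℕ) [Fact ℓ.Prime] (ι : PadicAlgCl ℓ ≃+* ℂ) (ρ : FramedGaloisRep K (PadicAlgCl ℓ) n),
        ρ.toGaloisRep.IsIrreducible → IsPinnedGeometric ρ →
        IsShapedProAutomorphic hcpt ι ρ → IsNonBanallyShapedProAutomorphic hcpt ι ρ :=
  Iff.rfl

/-- NBC unfolded (non-banally shaped ⇒ pro-automorphic of bounded level). -/
theorem nonBanalConfinement_iff : NonBanalConfinement ↔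
    ∀ (K : Type) [Field K] [NumberField K] (n : ℕ) (hcpt : isCompact_glFiniteIntegralLevel n K), 0 < n →
      ∀ (ℓ : ℕ) [Fact ℓ.Prime] (ι : PadicAlgCl ℓ ≃+* ℂ) (ρ : FramedGaloisRep K (PadicAlgCl ℓ) n),
        ρ.toGaloisRep.IsIrreducible → IsPinnedGeometric ρ →
        IsNonBanallyShapedProAutomorphic hcpt ι ρ → IsProAutomorphic hcpt ι ρ :=
  Iff.rfl

/-! ## 4. Kernel lemmas on the ladder of depths  H∞ ⟸ H♯ ⟸ H♭ ⟸ C -/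

section Kernel

variable {K : Type} [Field K] [NumberField K] {n : ℕ} {hcpt : isCompact_glFiniteIntegralLevel n K} {ℓ : ℕ} [Fact ℓ.Prime]
  {ι : PadicAlgCl ℓ ≃+* ℂ} {ρ : FramedGaloisRep K (PadicAlgCl ℓ) n}

/-- H♭ ⇒ H♯: forget the banality clause. -/
theorem shaped_of_nonBanallyShaped (h : IsNonBanallyShapedProAutomorphic hcpt ι ρ) : IsShapedProAutomorphic hcpt ι ρ := by
  obtain ⟨S₀, hS₀, h⟩ := h
  refine ⟨S₀, hS₀, fun r hr => ?_⟩
  obtain ⟨π, hπ, hae, hsh⟩ := h r hr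
  exact ⟨π, hπ, hae, fun v hv => (hsh v hv).imp_right fun h' => ⟨h'.1, h'.2.1⟩⟩

/-- C ⇒ H♭: one finite `S` good for every radius is a fortiori a non-banal shaping set (first disjunct everywhere off `S`). -/
theorem nonBanallyShaped_of_pro (h : IsProAutomorphic hcpt ι ρ) : IsNonBanallyShapedProAutomorphic hcpt ι ρ := by
  obtain ⟨S, hS, h⟩ := h
  refine ⟨S, hS, fun r hr => ?_⟩
  obtain ⟨π, hπ, hclose⟩ := h r hr
  refine ⟨π, hπ, Filter.eventually_cofinite.mpr (hS.subset fun w hw => ?_), fun v hv => Or.inl (hclose v hv)⟩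
  by_contra hwS
  exact hw (hclose w hwS)

/-- H♭ ⇒ H∞ (through H♯). -/
theorem levelFree_of_nonBanallyShaped (h : IsNonBanallyShapedProAutomorphic hcpt ι ρ) : IsLevelFreeProAutomorphic hcpt ι ρ :=
  levelFree_of_shaped (shaped_of_nonBanallyShaped h)

/-- weak automorphy ⇒ H♭ (constant family). -/
theorem nonBanallyShaped_of_weakly (h : IsWeaklyAutomorphic hcpt ι ρ) : IsNonBanallyShapedProAutomorphic hcpt ι ρ :=
  nonBanallyShaped_of_pro (pro_of_weakly h)

end Kernel

/-! ## 5. The node: deciding theorems, necessity from the target, THE ONE EQUIV -/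

/-- DECIDING THEOREM of the split of the residual: BNS → NBC → ILC, concluding ILC BY NAME; both binders used. -/
theorem closes_residual (h₁ : BanalShaping) (h₂ : NonBanalConfinement) : IwahoriLevelConfinement := by
  intro K _ _ n hcpt hn ℓ _ ι ρ hirr hgeo hsh
  exact h₂ K n hcpt hn ℓ ι ρ hirr hgeo (h₁ K n hcpt hn ℓ ι ρ hirr hgeo hsh)

/-- The curried residual assembly Prop is inhabited. -/
theorem residualAssembly_proof : ResidualAssembly := fun h₁ h₂ => closes_residual h₁ h₂

/-- DECIDING THEOREM of the three-binder child route of U (D-0027 §2.1): SSH → BNS → NBC → U, U by name, all three binders used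
(through the gen-25 tree theorem `IwahoriTransient.closes_target`). -/
theorem closes_target3 (hS : SemistableShaping) (h₁ : BanalShaping) (h₂ : NonBanalConfinement) :
    Summit.Langlands.Langlands.Theses.AuxiliaryLevelSplit.LevelFiniteness :=
  Summit.Langlands.Langlands.Theorems.IwahoriTransient.closes_target hS (closes_residual h₁ h₂)

/-- The curried child assembly Prop is inhabited. -/
theorem childAssembly3_proof : ChildAssembly3 := fun hS h₁ h₂ => closes_target3 hS h₁ h₂

/-- NECESSITY: ILC ⇒ BNS (bounded level is a fortiori non-banally shaped: C ⇒ H♭). -/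
theorem banalShaping_of_confinement (h : IwahoriLevelConfinement) : BanalShaping := by
  intro K _ _ n hcpt hn ℓ _ ι ρ hirr hgeo hsh
  exact nonBanallyShaped_of_pro (h K n hcpt hn ℓ ι ρ hirr hgeo hsh)

/-- NECESSITY: ILC ⇒ NBC (H♭ ⇒ H♯, then ILC). -/
theorem nonBanalConfinement_of_confinement (h : IwahoriLevelConfinement) : NonBanalConfinement := by
  intro K _ _ n hcpt hn ℓ _ ι ρ hirr hgeo hfl
  exact h K n hcpt hn ℓ ι ρ hirr hgeo (shaped_of_nonBanallyShaped hfl)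

/-- THE ONE EQUIV of the node (lens-3): ILC ⟺ BNS ∧ NBC, modulo NOTHING. -/
theorem confinement_iff_pieces : IwahoriLevelConfinement ↔ BanalShaping ∧ NonBanalConfinement :=
  ⟨fun h => ⟨banalShaping_of_confinement h, nonBanalConfinement_of_confinement h⟩, fun h => closes_residual h.1 h.2⟩

/-- NECESSITY from U: U ⇒ BNS. -/
theorem banalShaping_of_levelFiniteness (hU : Summit.Langlands.Langlands.Theses.AuxiliaryLevelSplit.LevelFiniteness) : BanalShaping :=
  banalShaping_of_confinement (confinement_of_levelFiniteness hU)

/-- NECESSITY from U: U ⇒ NBC. -/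
theorem nonBanalConfinement_of_levelFiniteness (hU : Summit.Langlands.Langlands.Theses.AuxiliaryLevelSplit.LevelFiniteness) :
    NonBanalConfinement :=
  nonBanalConfinement_of_confinement (confinement_of_levelFiniteness hU)

/-- THREE-PIECE READING of the lineage target: U ⟺ SSH ∧ BNS ∧ NBC (exact; SSH = the gen-25 tree decl BY NAME). -/
theorem levelFiniteness_iff_banalPieces :
    Summit.Langlands.Langlands.Theses.AuxiliaryLevelSplit.LevelFiniteness ↔ SemistableShaping ∧ BanalShaping ∧ NonBanalConfinement :=
  ⟨fun h => ⟨shaping_of_levelFiniteness h, banalShaping_of_levelFiniteness h, nonBanalConfinement_of_levelFiniteness h⟩,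
    fun h => closes_target3 h.1 h.2.1 h.2.2⟩

/-! ## 6. Necessity from FERN (25024), from B_w (17414, by name) and from the summit — no EXCESS -/

/-- BNS is FERN-implied. -/
theorem banalShaping_of_fernSpread (hF : Summit.Langlands.Langlands.Theses.DepthPrimeSplit.FernSpread) : BanalShaping :=
  banalShaping_of_confinement (iwahoriLevelConfinement_of_fernSpread hF)

/-- NBC is FERN-implied. -/
theorem nonBanalConfinement_of_fernSpread (hF : Summit.Langlands.Langlands.Theses.DepthPrimeSplit.FernSpread) : NonBanalConfinement :=
  nonBanalConfinement_of_confinement (iwahoriLevelConfinement_of_fernSpread hF)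

/-- BNS is B_w-implied. -/
theorem banalShaping_of_weak (hB : Summit.Langlands.Langlands.Theses.PrimeSwitchSplit.WeakGeometricAutomorphy) : BanalShaping :=
  banalShaping_of_confinement (iwahoriLevelConfinement_of_weak hB)

/-- NBC is B_w-implied. -/
theorem nonBanalConfinement_of_weak (hB : Summit.Langlands.Langlands.Theses.PrimeSwitchSplit.WeakGeometricAutomorphy) : NonBanalConfinement :=
  nonBanalConfinement_of_confinement (iwahoriLevelConfinement_of_weak hB)

/-- BNS is implied by the summit. -/
theorem banalShaping_of_langlands (hL : _root_.Langlands) : BanalShaping :=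
  banalShaping_of_confinement (iwahoriLevelConfinement_of_langlands hL)

/-- NBC is implied by the summit. -/
theorem nonBanalConfinement_of_langlands (hL : _root_.Langlands) : NonBanalConfinement :=
  nonBanalConfinement_of_confinement (iwahoriLevelConfinement_of_langlands hL)

/-- ROOT-IMPLIED certificate for the whole three-binder child: the summit implies all three pieces. -/
theorem banalPieces_of_langlands (hL : _root_.Langlands) : SemistableShaping ∧ BanalShaping ∧ NonBanalConfinement :=
  ⟨semistableShaping_of_langlands hL, banalShaping_of_langlands hL, nonBanalConfinement_of_langlands hL⟩

/-! ## 7. Dial facts: where the banal/non-banal dichotomy degenerates (ℓ = 2, ℓ ≤ n + 1) and what it contains (q_v ≡ 1 mod ℓ) -/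

section Dial

variable {K : Type} [Field K] [NumberField K]

/-- `q_v ≡ 1 (mod ℓ)` places (Taylor–Wiles / Ribet-switch primes) are non-banal as soon as `n ≥ 1`. -/
theorem isNonBanalAt_of_dvd_sub_one {ℓ n : ℕ} (hn : 1 ≤ n) (v : HeightOneSpectrum (𝓞 K)) (h : ℓ ∣ v.residueCard - 1) :
    IsNonBanalAt ℓ n v :=
  Or.inr ⟨1, le_rfl, hn, by simpa using h⟩

/-- For `ℓ = 2` EVERY place is non-banal (q_v is even or odd): the dial is empty, BNS is void and NBC = ILC at ℓ = 2 — as in print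
(Mazur's principle is empty at ℓ = 2). -/
theorem isNonBanalAt_two {n : ℕ} (hn : 1 ≤ n) (v : HeightOneSpectrum (𝓞 K)) : IsNonBanalAt 2 n v := by
  rcases Nat.even_or_odd v.residueCard with h | h
  · exact Or.inl (even_iff_two_dvd.mp h)
  · refine isNonBanalAt_of_dvd_sub_one hn v ?_
    obtain ⟨k, hk⟩ := h
    exact ⟨k, by omega⟩

/-- Small primes are never banal: if `ℓ` is prime and `ℓ ≤ n + 1` then every place is non-banal for `(ℓ, n)` (Fermat: `q^(ℓ−1) ≡ 1`).
So the banal regime, where BNS has content, is `ℓ ≥ n + 2` («banal ⇒ ℓ > n»). -/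
theorem isNonBanalAt_of_le {ℓ n : ℕ} (hℓ : ℓ.Prime) (hle : ℓ ≤ n + 1) (v : HeightOneSpectrum (𝓞 K)) : IsNonBanalAt ℓ n v := by
  by_cases hdvd : ℓ ∣ v.residueCard
  · exact Or.inl hdvd
  · refine Or.inr ⟨ℓ - 1, ?_, by omega, ?_⟩
    · have := hℓ.two_le; omega
    · have hcop : Nat.Coprime ℓ v.residueCard := (Nat.Prime.coprime_iff_not_dvd hℓ).mpr hdvd
      have hmod : v.residueCard ^ (ℓ - 1) ≡ 1 [MOD ℓ] := Nat.ModEq.pow_card_sub_one_eq_one hℓ hcop.symm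
      have hq : v.residueCard ≠ 0 := by
        rintro h0; apply hdvd; rw [h0]; exact dvd_zero ℓ
      exact (Nat.modEq_iff_dvd' (Nat.one_le_pow _ _ (Nat.pos_of_ne_zero hq))).mp hmod.symm

end Dial

/-! ## 7b. The void-dial sector ℓ ≤ n + 1: BNS is PROVED there (typed BC5 rung of the deciding piece) and NBC = ILC there -/

section SmallPrimes

variable {K : Type} [Field K] [NumberField K] {n : ℕ} {hcpt : isCompact_glFiniteIntegralLevel n K} {ℓ : ℕ} [Fact ℓ.Prime]
  {ι : PadicAlgCl ℓ ≃+* ℂ} {ρ : FramedGaloisRep K (PadicAlgCl ℓ) n}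

/-- For prime `ℓ ≤ n + 1`, H♯ ⇒ H♭ for every `ρ` (every place is non-banal, `isNonBanalAt_of_le`). -/
theorem nonBanallyShaped_of_shaped_of_le (hle : ℓ ≤ n + 1) (h : IsShapedProAutomorphic hcpt ι ρ) :
    IsNonBanallyShapedProAutomorphic hcpt ι ρ := by
  obtain ⟨S₀, hS₀, h⟩ := h
  refine ⟨S₀, hS₀, fun r hr => ?_⟩
  obtain ⟨π, hπ, hae, hsh⟩ := h r hr
  exact ⟨π, hπ, hae, fun v hv => (hsh v hv).imp_right fun h' => ⟨h'.1, h'.2, isNonBanalAt_of_le (Fact.out : ℓ.Prime) hle v⟩⟩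

/-- For prime `ℓ ≤ n + 1`, H♭ ⟺ H♯. -/
theorem nonBanallyShaped_iff_shaped_of_le (hle : ℓ ≤ n + 1) :
    IsNonBanallyShapedProAutomorphic hcpt ι ρ ↔ IsShapedProAutomorphic hcpt ι ρ :=
  ⟨shaped_of_nonBanallyShaped, nonBanallyShaped_of_shaped_of_le hle⟩

end SmallPrimes

/-- RUNG · BNS on the void-dial sector, PROVED: for every K, n ≥ 1, prime ℓ ≤ n + 1, ι and every irreducible pinned-geometric ρ,
semistably shaped ⇒ non-banally shaped.  (ILC, U and the summit are NOT known on this sector; the rung is content-free — the dial is empty —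
and is recorded as the typed BC5 witness that BNS is strictly smaller than ILC in scope: on this sector NBC carries ALL of ILC.) -/
theorem banalShaping_smallPrimes :
    ∀ (K : Type) [Field K] [NumberField K] (n : ℕ) (hcpt : isCompact_glFiniteIntegralLevel n K), 0 < n →
      ∀ (ℓ : ℕ) [Fact ℓ.Prime] (ι : PadicAlgCl ℓ ≃+* ℂ) (ρ : FramedGaloisRep K (PadicAlgCl ℓ) n), ℓ ≤ n + 1 →
        ρ.toGaloisRep.IsIrreducible → IsPinnedGeometric ρ →
        IsShapedProAutomorphic hcpt ι ρ → IsNonBanallyShapedProAutomorphic hcpt ι ρ := by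
  intro K _ _ n hcpt hn ℓ _ ι ρ hle _hirr _hgeo hsh
  exact nonBanallyShaped_of_shaped_of_le hle hsh

/-- On the void-dial sector NBC restricted = ILC restricted (pointwise): the residual keeps everything there. -/
theorem confinement_smallPrimes_iff (K : Type) [Field K] [NumberField K] (n : ℕ) (hcpt : isCompact_glFiniteIntegralLevel n K)
    (ℓ : ℕ) [Fact ℓ.Prime] (ι : PadicAlgCl ℓ ≃+* ℂ) (ρ : FramedGaloisRep K (PadicAlgCl ℓ) n) (hle : ℓ ≤ n + 1) :
    (IsNonBanallyShapedProAutomorphic hcpt ι ρ → IsProAutomorphic hcpt ι ρ) ↔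
      (IsShapedProAutomorphic hcpt ι ρ → IsProAutomorphic hcpt ι ρ) := by
  rw [nonBanallyShaped_iff_shaped_of_le hle]

/-! ## 8. MODEL WITNESSES of separation (BC5-style, purely combinatorial): the two pieces are independent of each other.
A «toy shaping datum» on a place type `P` with depths `k : ℕ`: `close k v`, `bad k v` (= Iwahori ∧ level-raising) and `nb v` (= non-banal). -/

section Model

/-- toy H♯: off the finite set `S₀`, at every depth every place is close or bad; closeness holds cofinitely. -/
def ToySharp {P : Type} (close bad : ℕ → P → Prop) (S₀ : Set P) : Prop :=
  ∀ k, (∀ᶠ v in cofinite, close k v) ∧ ∀ v, v ∉ S₀ → close k v ∨ bad k v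

/-- toy H♭: the same with every bad place non-banal. -/
def ToyFlat {P : Type} (close bad : ℕ → P → Prop) (nb : P → Prop) (S₀ : Set P) : Prop :=
  ∀ k, (∀ᶠ v in cofinite, close k v) ∧ ∀ v, v ∉ S₀ → close k v ∨ (bad k v ∧ nb v)

/-- toy C: one finite set off which every depth is close everywhere. -/
def ToyBounded {P : Type} (close : ℕ → P → Prop) : Prop :=
  ∃ S : Set P, S.Finite ∧ ∀ k, ∀ v, v ∉ S → close k v

/-- The escaping toy system on `P = ℕ`: at depth `k` the places `v < k` are bad, the others close. -/
def escClose (k v : ℕ) : Prop := k ≤ v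

/-- At every depth the escaping system is close cofinitely. -/
theorem escClose_cofinite (k : ℕ) : ∀ᶠ v in cofinite, escClose k v := by
  simp only [escClose, Filter.eventually_cofinite, not_le]
  exact Set.finite_lt_nat k

/-- The escaping system admits no uniform finite exceptional set (toy C fails). -/
theorem not_toyBounded_esc : ¬ ToyBounded escClose := by
  rintro ⟨S, hS, h⟩
  obtain ⟨m, hm⟩ := hS.bddAbove
  have hmem : m + 1 ∉ S := fun hx => by have := hm hx; omega
  have := h (m + 2) (m + 1) hmem
  simp [escClose] at this

/-- WORLD A (every place non-banal — the ℓ = 2 world): the BNS-analogue holds (H♯ ⇒ H♭ for every S₀) while the NBC-analogue fails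
(H♭ holds with S₀ = ∅ but C fails).  So «H♯ ⇒ H♭» does not give «H♭ ⇒ C». -/
theorem worldA_separates :
    (∀ S₀ : Set ℕ, ToySharp escClose (fun k v => ¬ escClose k v) S₀ → ToyFlat escClose (fun k v => ¬ escClose k v) (fun _ => True) S₀) ∧
    ToyFlat escClose (fun k v => ¬ escClose k v) (fun _ => True) ∅ ∧ ¬ ToyBounded escClose := by
  refine ⟨fun S₀ h k => ⟨(h k).1, fun v hv => ((h k).2 v hv).imp_right fun hb => ⟨hb, trivial⟩⟩,
    fun k => ⟨escClose_cofinite k, fun v _ => ?_⟩, not_toyBounded_esc⟩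
  by_cases h : escClose k v
  · exact Or.inl h
  · exact Or.inr ⟨h, trivial⟩

/-- WORLD B (every place banal): the NBC-analogue holds vacuously-in-content (H♭ forces closeness off S₀, hence C) while the
BNS-analogue fails (H♯ holds with S₀ = ∅, H♭ fails for every finite S₀).  So «H♭ ⇒ C» does not give «H♯ ⇒ H♭». -/
theorem worldB_separates :
    (∀ S₀ : Set ℕ, S₀.Finite → ToyFlat escClose (fun k v => ¬ escClose k v) (fun _ => False) S₀ → ToyBounded escClose) ∧
    ToySharp escClose (fun k v => ¬ escClose k v) ∅ ∧
    ∀ S₀ : Set ℕ, S₀.Finite → ¬ ToyFlat escClose (fun k v => ¬ escClose k v) (fun _ => False) S₀ := by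
  refine ⟨fun S₀ hS₀ h => ⟨S₀, hS₀, fun k v hv => ((h k).2 v hv).elim id fun hb => hb.2.elim⟩,
    fun k => ⟨escClose_cofinite k, fun v _ => by by_cases h : escClose k v <;> simp [h]⟩, fun S₀ hS₀ h => ?_⟩
  obtain ⟨m, hm⟩ := hS₀.bddAbove
  have hmem : m + 1 ∉ S₀ := fun hx => by have := hm hx; omega
  rcases (h (m + 2)).2 (m + 1) hmem with hc | ⟨_, hf⟩
  · simp [escClose] at hc
  · exact hf

end Model

/-! ## 9. The frames: parent and root deciding theorems with U replaced by SSH, BNS, NBC -/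

/-- Parent frame: G → SSH → BNS → NBC → FERN through `AuxiliaryLevelSplit.closes`. -/
theorem closes_parent_banal (hG : Summit.Langlands.Langlands.Theses.AuxiliaryLevelSplit.LevelFreeFern) (hS : SemistableShaping)
    (h₁ : BanalShaping) (h₂ : NonBanalConfinement) : Summit.Langlands.Langlands.Theses.DepthPrimeSplit.FernSpread :=
  Summit.Langlands.Langlands.Theses.AuxiliaryLevelSplit.closes hG (closes_target3 hS h₁ h₂)

/-- Root frame: the great-grandparent's deciding theorem with FERN replaced by G, SSH, BNS, NBC (eleven binders → the summit). -/
theorem closes_root_banal (hD : Summit.Langlands.Langlands.Theses.DepthPrimeSplit.DyadicSeed) (hO : Summit.Langlands.Langlands.Theses.DepthPrimeSplit.OddPrimeSeed)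
    (hG : Summit.Langlands.Langlands.Theses.AuxiliaryLevelSplit.LevelFreeFern) (hS : SemistableShaping) (h₁ : BanalShaping) (h₂ : NonBanalConfinement)
    (hC : Summit.Langlands.Langlands.Theses.DepthPrimeSplit.Classicality) (hW : Summit.Langlands.Langlands.Theses.DepthPrimeSplit.SatakeAvatarExistence)
    (hP : Summit.Langlands.Langlands.Theses.DepthPrimeSplit.PadicMemberCompatibility)
    (hA : Summit.Langlands.Langlands.Theses.DepthPrimeSplit.CompatibilityAwayFromLR) (hR : Summit.Langlands.Langlands.Theses.DepthPrimeSplit.CanonicalReciprocityData) :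
    _root_.Langlands :=
  Summit.Langlands.Langlands.Theses.DepthPrimeSplit.closes hD hO (closes_parent_banal hG hS h₁ h₂) hC hW hP hA hR

#print axioms closes_residual
#print axioms closes_target3
#print axioms confinement_iff_pieces
#print axioms levelFiniteness_iff_banalPieces
#print axioms banalPieces_of_langlands
#print axioms isNonBanalAt_of_le
#print axioms banalShaping_smallPrimes
#print axioms worldA_separates
#print axioms closes_root_banal

end Summit.Langlands.Langlands.Theorems.BanalLevel
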